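import Summits.ResolutionOfSingularities.ResolutionOfSingularities.Theorems.PurelyInseparableDim4ChartDictionary
import Literature.AlgebraicGeometry.Resolution.CentreBlowupMohStability
import Literature.AlgebraicGeometry.Resolution.PointBlowupKangaroo
import Mathlib.Algebra.CharP.Lemmas
import HarnessLib
import HarnessLib.Audit.Tags

/-!
# Purely inseparable hypersurfaces `z^q + F(x)` — STRAIGHTENING LEMMAS for free tails (G2, polynomial part)
# [OURS · counted 0 · cell res-dim4-pi · F4-I(3,3) band half · p-12's located reduction 18:33Z (i)(ii) · p-9 (Lean)]

Census cell «res-dim4-pi» (D-0157 DOOR 2).  The load-bearing open item of the isolated regime at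
`(p,q) = (3,3)` is the FREE-TAIL LEMMA `FreeTail.NoIsolatedFreeTailAt 3 3` (card I-7-2, res-dim4-idea-7;
assembly `IsolatedBand.noIsolatedTrap_three_three_iff_freeTail_and_coneTwo`, res-dim4-p-5).  Its hand
proof STRAIGHTENS a free tail (all steps in one chart `j`, arbitrary translations) into a sequence of
chart-origin blow-ups of a re-coordinatised polynomial and then runs the frozen-monomial argument
(`IsoSpine`).  This file lands the three POLYNOMIAL identities the straightening uses (res-dim4-p-12's
located reduction of 2026-08-28T18:33Z, items (i)–(ii); every finite index type `σ`, every commutative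
ring resp. characteristic `p`):

* §1 **SHEAR CONJUGATION** (`translate_chartTransform_univ_eq_chartTransform_shear`): for `b_j = 0`
  and `q ≤ ord₀ F`, `translate b (chartTransform q univ j F) = chartTransform q univ j (shear j b F)`
  — a translated point of the `x_j`-chart of the POINT blow-up is the chart origin of the blow-up of the
  SHEARED polynomial `F(x_i + b_i x_j, x_j)` (Hauser's `P⁺`; the tree's two-letter
  `translate_chartTransform_eq_chartTransform_shear` in every number of variables); hence
  `step_F_eq_step_F_shear`: `(step q univ j b s).F = (step q univ j 0 ⟨shear j b s.F, …⟩).F`.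
* §2 **TRIANGULAR SUBSTITUTIONS COMMUTE PAST THE CHART MAP** (`subst_comp_coordBlowupSubst`): with
  `σ_j : x_i ↦ x_j x_i (i ≠ j)`, a triangular substitution `x_i ↦ x_i + x_j ψ_i` (`ψ_i` a polynomial
  in `x_j`) AFTER `σ_j` equals `x_i ↦ x_i + x_j² ψ_i`… precisely `σ_j ∘ Θ'_ψ = Θ_{x_j ψ} ∘ σ_j` on
  polynomials, for every family `ψ` fixed by `σ_j`.
* §3 **CLEANING COMMUTES WITH EVERY SUBSTITUTION UP TO RE-CLEANING** in characteristic `p`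
  (`deletePthPowers_aeval_deletePthPowers`): `deletePthPowers p (Θ (deletePthPowers p G)) =
  deletePthPowers p (Θ G)` for every `K`-algebra substitution `Θ = aeval θ` — the deleted part of `G` is a
  `p`-th power, so is its image (Frobenius), and cleaning kills it.

What is NOT here: the quantitative frozen-monomial bound along the straightened tail (p-12's (iii)/(iv))
and the free chart-switch residual (formal arcs: `FormalIsolation.not_isIsolated_of_formalArc`,
p657259).  Nothing in this file is a statement about resolution of singularities; resolution in
dimension ≥ 4 / characteristic `p` is NOT proved anywhere in this programme; counted 0; AI
formalisation, weaker than expert review.  bears_on: LADDER-RESOLUTION:D157-DOOR2 (res-dim4-pi · G2).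
Supports stmt-ResolutionOfSingularities-16155 (helper).
-/

set_option linter.dupNamespace false

noncomputable section

open MvPolynomial Finset

namespace Summit.ResolutionOfSingularities.ResolutionOfSingularities.Theorems.PIDim4.Straightening

open Literature.AlgebraicGeometry.Resolution
open Literature.AlgebraicGeometry.Resolution.Hauser2010
open Literature.AlgebraicGeometry.Resolution.CentreBlowup

/-! ## 1. Shear conjugation: translated chart point = chart origin of the sheared polynomial -/

section Shear

variable {σ : Type*} [Fintype σ] [DecidableEq σ] {K : Type*} [Field K]

omit [Fintype σ] in
/-- The shear `x_i ↦ x_i + b_i x_j (i ≠ j)`, `x_j ↦ x_j` sends a monomial of degree `n` to a homogeneous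
polynomial of degree `n` (its generators are linear forms). [cite: Hauser2010, §I (definition of P⁺)] -/
theorem isHomogeneous_shear_monomial (j : σ) (b : σ → K) (d : σ →₀ ℕ) (c : K) :
    (shear j b (monomial d c)).IsHomogeneous (d.degree) := by
  have h := (isHomogeneous_monomial (d := d) c rfl).aeval
    (fun i => if i = j then (X j : MvPolynomial σ K) else X i + C (b i) * X j) (n := 1) (fun i => by
      by_cases hij : i = j
      · simp only [hij, if_true]
        exact isHomogeneous_X _ _
      · simp only [hij, if_false]
        exact (isHomogeneous_X _ _).add (isHomogeneous_C_mul_X _ _))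
  rw [one_mul] at h
  exact h

omit [DecidableEq σ] in
/-- The shear does not lower the order along the point: `q ≤ ord_{univ} F ⇒ q ≤ ord_{univ} (shear j b F)`.
[folklore] -/
theorem le_ordAlong_univ_shear [DecidableEq σ] (j : σ) (b : σ → K) {q : ℕ} {F : MvPolynomial σ K}
    (hq : (q : ℕ∞) ≤ ordAlong Finset.univ F) : (q : ℕ∞) ≤ ordAlong Finset.univ (shear j b F) := by
  classical
  rw [le_ordAlong_iff]
  intro e he
  have hsum : shear j b F = ∑ d ∈ F.support, shear j b (monomial d (coeff d F)) := by
    conv_lhs => rw [F.as_sum]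
    unfold shear
    rw [map_sum]
  have he' : coeff e (∑ d ∈ F.support, shear j b (monomial d (coeff d F))) ≠ 0 := by
    rw [← hsum]
    exact MvPolynomial.mem_support_iff.mp he
  rw [coeff_sum] at he'
  obtain ⟨d, hd, hde⟩ := Finset.exists_ne_zero_of_sum_ne_zero he'
  have hhom := isHomogeneous_shear_monomial j b d (coeff d F)
  have hdeg : d.degree = ∑ i ∈ e.support, e i :=
    hhom.degree_eq_sum_deg_support (MvPolynomial.mem_support_iff.mpr hde)
  have h1 := (le_ordAlong_iff.mp hq) d hd
  rw [degIn_univ] at h1 ⊢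
  rw [Finsupp.degree_apply, ← hdeg]
  exact h1

omit [Fintype σ] in
/-- `τ_b ∘ σ_j = σ_j ∘ θ_b` as `K`-algebra maps (`b_j = 0`): translating the chart point after the chart
substitution `σ_j : x_i ↦ x_j x_i` is the chart substitution after the shear `θ_b`.
[cite: Hauser2010, §I (P⁺)] -/
theorem translate_comp_coordBlowupSubst [Fintype σ] (j : σ) (b : σ → K) (hbj : b j = 0) :
    (aeval fun i => (X i + C (b i) : MvPolynomial σ K)).comp
        (coordBlowupSubst K ((Finset.univ : Finset σ) : Set σ) j) =
      (coordBlowupSubst K ((Finset.univ : Finset σ) : Set σ) j).comp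
        (aeval fun i => if i = j then (X j : MvPolynomial σ K) else X i + C (b i) * X j) := by
  classical
  refine MvPolynomial.algHom_ext fun i => ?_
  rw [AlgHom.comp_apply, AlgHom.comp_apply, aeval_X, coordBlowupSubst_X]
  by_cases hij : i = j
  · subst hij
    rw [if_neg (fun h => h.2 rfl), if_pos rfl, aeval_X, coordBlowupSubst_X, if_neg (fun h => h.2 rfl),
      hbj, map_zero, add_zero]
  · have hmem : i ∈ ((Finset.univ : Finset σ) : Set σ) ∧ i ≠ j :=
      ⟨Finset.mem_coe.mpr (Finset.mem_univ i), hij⟩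
    rw [if_pos hmem, if_neg hij, map_mul, aeval_X, aeval_X, hbj, map_zero, add_zero, map_add, map_mul,
      coordBlowupSubst_X, if_pos hmem, coordBlowupSubst_C, coordBlowupSubst_X, if_neg (fun h => h.2 rfl)]
    ring

/-- **SHEAR CONJUGATION** (every finite index type, every field, every `q ≤ ord_{univ} F`): for a point
`b` of the `x_j`-chart of the point blow-up (`b_j = 0`),
`translate b (chartTransform q univ j F) = chartTransform q univ j (shear j b F)` — the translated chart
transform is the chart ORIGIN transform of Hauser's sheared polynomial `P⁺(x) = P(x_i + b_i x_j)`.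
(The `n`-variable form of the tree's two-letter `PointBlowup.translate_chartTransform_eq_chartTransform_shear`.)
[cite: Hauser2010, §I (P⁺)] [cite: HauserPerlega2024, §4 p. 779 (F′_t(x,y) = x^{−q} F_t(x, xy))] -/
theorem translate_chartTransform_univ_eq_chartTransform_shear (q : ℕ) (j : σ) (b : σ → K)
    (hbj : b j = 0) (F : MvPolynomial σ K) (hq : (q : ℕ∞) ≤ ordAlong Finset.univ F) :
    PointBlowup.translate b (chartTransform q Finset.univ j F) =
      chartTransform q Finset.univ j (shear j b F) := by
  classical
  have hj : j ∈ (Finset.univ : Finset σ) := Finset.mem_univ j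
  have h1 := ChartDictionary.coordBlowupSubst_eq_X_pow_mul_chartTransform (K := K) hj q F hq
  have h2 := ChartDictionary.coordBlowupSubst_eq_X_pow_mul_chartTransform (K := K) hj q (shear j b F)
    (le_ordAlong_univ_shear j b hq)
  -- apply the translation to `h1` and compare with `h2` through `τ_b ∘ σ_j = σ_j ∘ θ_b`
  have h3 := congrArg (aeval fun i => (X i + C (b i) : MvPolynomial σ K)) h1
  have hcomp := congrArg (fun φ : MvPolynomial σ K →ₐ[K] MvPolynomial σ K => φ F)
    (translate_comp_coordBlowupSubst j b hbj)
  simp only [AlgHom.comp_apply] at hcomp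
  rw [hcomp] at h3
  change coordBlowupSubst K _ j (shear j b F) = _ at h3
  rw [h2, map_mul, map_pow, aeval_X, hbj, map_zero, add_zero] at h3
  -- cancel `x_j^q`
  have hX : (X j : MvPolynomial σ K) ^ q ≠ 0 := pow_ne_zero _ (X_ne_zero j)
  have h4 := mul_left_cancel₀ hX h3
  -- `h4 : chartTransform (shear F) = translate b (chartTransform F)`
  exact h4.symm

variable [DecidableEq K]

/-- **The translated step is the origin step of the sheared state** (residual polynomials): for
`b_j = 0` and `q ≤ ord_{univ} F`, `(step q univ j b s).F = (step q univ j 0 ⟨shear j b s.F, r', exc'⟩).F`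
for any bookkeeping `r', exc'`. [cite: Hauser2010, §I (P⁺)] -/
theorem step_F_eq_step_F_shear (q : ℕ) (j : σ) (b : σ → K) (hbj : b j = 0) (s : CState σ K)
    (hq : (q : ℕ∞) ≤ ordAlong Finset.univ s.F) (r' : σ →₀ ℕ) (exc' : Finset σ) :
    (step q Finset.univ j b s).F =
      (step q Finset.univ j (0 : σ → K) ⟨shear j b s.F, r', exc'⟩).F := by
  change deletePthPowers q (PointBlowup.translate b (chartTransform q Finset.univ j s.F)) =
    deletePthPowers q (PointBlowup.translate 0 (chartTransform q Finset.univ j (shear j b s.F)))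
  rw [PointBlowup.translate_zero, translate_chartTransform_univ_eq_chartTransform_shear q j b hbj s.F hq]

end Shear

/-! ## 2. Triangular substitutions commute past the chart map -/

section Triangular

variable {σ : Type*} [DecidableEq σ] {K : Type*} [CommRing K]

/-- **Triangular substitutions commute past the chart map.** Let `σ_j = coordBlowupSubst K univ j`
(`x_i ↦ x_j x_i` for `i ≠ j`, `x_j ↦ x_j`) and let `ψ : σ → K[x]` be fixed by `σ_j` (e.g. polynomials in
`x_j` alone). Then, as `K`-algebra endomorphisms of `K[x]`, `σ_j ∘ Θ_{x_j ψ} = Θ'_ψ ∘ σ_j` where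
`Θ_{x_jψ} : x_i ↦ x_i + x_j ψ_i` and `Θ'_ψ : x_i ↦ x_i + ψ_i` (`i ≠ j`; `x_j ↦ x_j`): a triangular
re-coordinatisation by `x_j ψ` on the blown-up side is the re-coordinatisation by `ψ` downstairs.
[folklore] -/
theorem coordBlowupSubst_comp_subst (j : σ) (ψ : σ → MvPolynomial σ K)
    (hψ : ∀ i, coordBlowupSubst K (Set.univ : Set σ) j (ψ i) = ψ i) :
    (coordBlowupSubst K (Set.univ : Set σ) j).comp
        (aeval fun i => if i = j then (X j : MvPolynomial σ K) else X i + X j * ψ i) =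
      (aeval fun i => if i = j then (X j : MvPolynomial σ K) else X i + ψ i).comp
        (coordBlowupSubst K (Set.univ : Set σ) j) := by
  classical
  refine MvPolynomial.algHom_ext fun i => ?_
  rw [AlgHom.comp_apply, AlgHom.comp_apply, aeval_X, coordBlowupSubst_X]
  by_cases hij : i = j
  · subst hij
    rw [if_pos rfl, if_neg (fun h => h.2 rfl), coordBlowupSubst_X, if_neg (fun h => h.2 rfl), aeval_X,
      if_pos rfl]
  · have hmem : i ∈ (Set.univ : Set σ) ∧ i ≠ j := ⟨Set.mem_univ i, hij⟩
    rw [if_neg hij, if_pos hmem, map_add, map_mul, coordBlowupSubst_X, if_pos hmem, coordBlowupSubst_X,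
      if_neg (fun h => h.2 rfl), hψ i, map_mul, aeval_X, aeval_X, if_pos rfl, if_neg hij]
    ring

end Triangular

/-! ## 3. Cleaning commutes with every substitution up to re-cleaning (characteristic `p`) -/

section Cleaning

variable {σ : Type*} [DecidableEq σ] {K : Type*} [Field K] (p : ℕ) [hp : Fact p.Prime] [CharP K p]

omit hp [CharP K p] in
/-- Cleaning commutes with scalar factors. [cite: Hauser2010, §G (cleaning)] -/
theorem deletePthPowers_smul (q : ℕ) (c : K) (P : MvPolynomial σ K) :
    deletePthPowers q (c • P) = c • deletePthPowers q P := by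
  ext d
  rw [coeff_deletePthPowers, coeff_smul, coeff_smul, coeff_deletePthPowers]
  split_ifs <;> simp

/-- The `p`-th power of a polynomial is cleaned to zero: in characteristic `p`,
`(Σ a_m x^m)^p = Σ a_m^p x^{p m}` has `p`-th-power monomials only. [folklore] -/
theorem deletePthPowers_pow_char (Q : MvPolynomial σ K) : deletePthPowers p (Q ^ p) = 0 := by
  classical
  have hQ : Q ^ p = ∑ m ∈ Q.support, monomial (p • m) (coeff m Q ^ p) := by
    conv_lhs => rw [Q.as_sum]
    rw [sum_pow_char]
    refine Finset.sum_congr rfl fun m _ => ?_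
    rw [monomial_pow]
  rw [hQ, deletePthPowers_finset_sum]
  refine Finset.sum_eq_zero fun m _ => ?_
  rw [deletePthPowers_monomial, if_pos]
  intro i _
  exact ⟨m i, by simp [Finsupp.smul_apply, smul_eq_mul]⟩

omit hp [CharP K p] in
/-- A `p`-th-power monomial is the `p`-th power of a monomial, so every substitution sends it to a `p`-th
power. [folklore] -/
theorem aeval_monomial_eq_pow_of_isPthPowerExponent (θ : σ → MvPolynomial σ K) {d : σ →₀ ℕ}
    (hd : IsPthPowerExponent p d) (c : K) :
    ∃ Q : MvPolynomial σ K, aeval θ (monomial d c) = c • Q ^ p := by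
  classical
  -- `d = p • d'`
  set d' : σ →₀ ℕ := Finsupp.mapRange (· / p) (Nat.zero_div _) d with hd'
  have hdd : p • d' = d := by
    ext i
    simp only [Finsupp.coe_smul, Pi.smul_apply, smul_eq_mul, Finsupp.mapRange_apply, hd']
    by_cases hi : i ∈ d.support
    · exact Nat.mul_div_cancel' (hd i hi)
    · rw [Finsupp.notMem_support_iff.mp hi]; simp
  set M : MvPolynomial σ K := monomial d' (1 : K) with hM
  refine ⟨aeval (R := K) θ M, ?_⟩
  have hm : monomial d c = c • M ^ p := by
    rw [hM, monomial_pow, one_pow, hdd, smul_monomial, smul_eq_mul, mul_one]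
  rw [hm, map_smul, map_pow]

/-- **CLEANING COMMUTES WITH EVERY SUBSTITUTION UP TO RE-CLEANING** (characteristic `p`, `p` prime, every
index type, every field): for every `K`-algebra substitution `Θ = aeval θ`,
`deletePthPowers p (Θ (deletePthPowers p G)) = deletePthPowers p (Θ G)` — the monomials deleted from `G`
are `p`-th powers, `Θ` maps them to `p`-th powers (Frobenius), and the final cleaning deletes those.
(Special cases in the tree: translations `MohAlong.deletePthPowers_translate_…`, the chart transform
`deletePthPowers_chartTransform`.) [cite: Hauser2010, §G (cleaning)] -/
theorem deletePthPowers_aeval_deletePthPowers (θ : σ → MvPolynomial σ K) (G : MvPolynomial σ K) :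
    deletePthPowers p (aeval θ (deletePthPowers p G)) = deletePthPowers p (aeval θ G) := by
  classical
  -- split `G` into its clean part and its `p`-th-power part
  have hsplit : G = deletePthPowers p G +
      ∑ d ∈ G.support with IsPthPowerExponent p d, monomial d (coeff d G) := by
    conv_lhs => rw [G.as_sum]
    rw [← Finset.sum_filter_add_sum_filter_not G.support (IsPthPowerExponent p), add_comm]
    rfl
  conv_rhs => rw [hsplit]
  rw [map_add, deletePthPowers_add, map_sum, deletePthPowers_finset_sum]
  rw [Finset.sum_eq_zero, add_zero]
  intro d hd
  obtain ⟨Q, hQ⟩ := aeval_monomial_eq_pow_of_isPthPowerExponent p θ (Finset.mem_filter.mp hd).2 (coeff d G)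
  rw [hQ, deletePthPowers_smul, deletePthPowers_pow_char, smul_zero]

end Cleaning

end Summit.ResolutionOfSingularities.ResolutionOfSingularities.Theorems.PIDim4.Straightening

end
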